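import Mathlib
import HarnessLib
import Summits.HubbardSuperconductivity.HubbardSuperconductivity.Theorems.KLProgrammeKLRegimeSplitGenericV2

/-!
# Route `KLProgramme` — generic children of crux K3 `KLRegimeTwoPointLimit` (stmt-HubbardSuperconductivity-19937), VERSION 3:
# the scale ladder runs ONE STEP FURTHER (`n ≤ n_β + 1`, the fully integrated action) and a FIFTH child `VolumeLimitP` exports the
# termwise volume limits that the two-point assembly consumes (defect «Δ-asm», hubbard-kl-r2d-p2 2026-08-26T12:50:27Z; director
# 12:54:21Z (T2)).  Glue `inductionP3` / `k3_inductionP3` / `k3_twoPointLimit_of_childrenP3` PROVED for every bundle.  Seat p2, g4.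

Δ-asm (A): every per-scale slot is a conjunction of (in)equalities at ONE volume `(L, M)`; no slot relates two volumes or names an
`L`-independent limit object, while child 4's conclusion is a Cauchy property in `L` of the model's two-point function — in the KL
regime there is no `L`-uniform disc of `U`-analyticity to pass from bounds to limits (Vitali / Tannery devices of the tree need one), and
the printed proofs use TERMWISE volume convergence of the expansion, which is engine-internal.  Δ-asm (B): at `n = n_β = nScales β` the
action `klEffectiveAction … n_β` (`Λ_{n_β} ∈ (π/β, 4π/β]`) is not yet the fully integrated one; one more single-slice step reaches
`Λ_{n_β+1} ≤ π/β`, where `hubbardEffectiveActionCT` IS `effAction C^K V_K` and the two-point function is read by the source-shift identity.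

Repair (this module; bodies of the per-scale predicates untouched, `Preds` untouched):
* (R1) `EngineP3` = the restaged engine child of `…SplitGenericV2` with the ladder `n ≤ nScales β + 1` (children 1 and 2 are the
  LANDED `BetaSplitP` / `CountertermP2`, range `n ≤ nScales β`, verbatim — plan g10 13:13:29Z (5): their items survive by signature;
  the last step reads the history they supply at `j ≤ n_β`); the KL-regime hypothesis `IsKLRegime U c (-n)` STILL holds at `n_β + 1`
  because `4e₀/π < 1` (`isKLRegime_of_le_nScales_succ`), so K3's existential `c` is unchanged.
* (R2) `TowerP` = the full tower of a frame beyond thresholds (four slots at `n ≤ n_β` + engine/two-leg at `n_β + 1`);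
  `VolumeLimitP Pr VL W` (child 5, engine-side, ranked with child 3): for an admissible frame carrying `TowerP`, the VOLUME-LIMIT predicate
  `VL β U μ K Mstar` holds — `VL : VolLimitSlot` is a SLOT of this module (the text of record, hubbard-kl-r2d-p2's
  `FinalTwoLegVolLimit β U μ K Mstar` = termwise `L`-limits of the fully integrated two-leg vertex function at every Matsubara label with a
  uniform bound, is bound where the children are named, exactly as `Preds` binds the per-scale slots — so this module stays pure
  logic); `TwoPointAssemblyP3 Pr VL W` = child 4 on `TowerP` with `VL` of THE SAME frame added to its hypothesis.
Order of choices in the glue: `G → P → R → Q → (c₀, c₁) → U₀` (five `U₀`'s), then per `(μ, U, β)`: children 3 + 1 by strong induction to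
`n_β` for every admissible frame, child 2's frame, the engine's last step at `n_β + 1` on that frame's history, child 5's volume limits,
child 4.  Children of record at a bundle `Pr` and a volume-limit text `VL`: `EngineP3 Pr W | BetaSplitP Pr W | CountertermP2 Pr W |
VolumeLimitP Pr VL W | TwoPointAssemblyP3 Pr VL W`.  Nothing here asserts anything about the Hubbard model.
-/

noncomputable section

namespace Summit.HubbardSuperconductivity.HubbardSuperconductivity.Theorems.KLRegimeSplit

set_option linter.dupNamespace false -- summit = problem name (single-conjunct summit), D-0017

open Real Finset Filter Literature.MathematicalPhysics.QuantumLattice Literature.Probability.LatticeModels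
open Literature.MathematicalPhysics.QuantumLattice.FermiRG
open Summit.HubbardSuperconductivity.HubbardSuperconductivity.Theorems.KLProgrammeLegKernels
open Summit.HubbardSuperconductivity.HubbardSuperconductivity.Theorems.DispersionFlow

/-! ## §1 The KL regime reaches one step below the temperature scale -/

/-- `4e₀/π ≤ 1` (`e₀ = 1/32`): the reason the ladder may run to `n_β + 1` inside the same regime constant. -/
theorem four_mul_klE0_div_pi_le_one : 4 * klE0 / Real.pi ≤ 1 := by
  rw [div_le_one Real.pi_pos, klE0]
  linarith [Real.pi_gt_three]

/-- **Every scale `n ≤ n_β + 1` is a KL-regime scale** in the regime `klBetaMin ≤ β ≤ e^{c/U²}`: `U²·n·log 4 ≤ c`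
(`n ≤ ⌊log₄(e₀β/π)⌋ + 1 ≤ log₄(e₀β/π) + 1 = log₄(4e₀β/π) ≤ log₄ β` since `4e₀/π ≤ 1`; `β ≥ 128` makes `log₄(e₀β/π) ≥ 0`). -/
theorem isKLRegime_of_le_nScales_succ {U c β : ℝ} {n : ℕ} (hc : 0 ≤ c) (hβmin : klBetaMin ≤ β)
    (hβc : β ≤ Real.exp (c / U ^ 2)) (hn : n ≤ nScales β + 1) : IsKLRegime U c (-(n : ℤ)) := by
  unfold IsKLRegime
  have hβ : 0 < β := pos_of_klBetaMin_le hβmin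
  have habs : |((-(n : ℤ) : ℤ) : ℝ)| = (n : ℝ) := by
    rw [Int.cast_neg, Int.cast_natCast, abs_neg, Nat.abs_cast]
  rw [habs]
  have hlog4 : 0 < Real.log 4 := Real.log_pos (by norm_num)
  set y : ℝ := Real.logb 4 (klE0 * β / Real.pi) with hy
  have hx : 0 < klE0 * β / Real.pi := by unfold klE0; positivity
  -- `y ≥ 0` because `e₀ β / π ≥ e₀ · 128 / π > 1`
  have hx1 : 1 ≤ klE0 * β / Real.pi := by
    rw [le_div_iff₀ Real.pi_pos, klE0]
    have : (128 : ℝ) ≤ β := by simpa [klBetaMin] using hβmin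
    nlinarith [Real.pi_lt_four]
  have hy0 : 0 ≤ y := Real.logb_nonneg (by norm_num) hx1
  have hn' : (n : ℝ) ≤ y + 1 := by
    have h1 : ((nScales β : ℕ) : ℝ) ≤ y := Nat.floor_le hy0
    have h2 : (n : ℝ) ≤ (nScales β : ℝ) + 1 := by exact_mod_cast hn
    linarith
  have hxβ : 4 * (klE0 * β / Real.pi) ≤ β := by
    have h := four_mul_klE0_div_pi_le_one
    have : 4 * (klE0 * β / Real.pi) = (4 * klE0 / Real.pi) * β := by ring
    rw [this]
    exact mul_le_of_le_one_left hβ.le h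
  have h1 : (n : ℝ) * Real.log 4 ≤ Real.log (4 * (klE0 * β / Real.pi)) := by
    have hylog : y * Real.log 4 = Real.log (klE0 * β / Real.pi) := by
      rw [hy, Real.logb, div_mul_cancel₀ _ hlog4.ne']
    rw [Real.log_mul (by norm_num) hx.ne', ← hylog]
    nlinarith [hn', hlog4]
  have h2 : Real.log (4 * (klE0 * β / Real.pi)) ≤ Real.log β := Real.log_le_log (by positivity) hxβ
  have h3 : Real.log β ≤ c / U ^ 2 := by
    have := Real.log_le_log hβ hβc
    rwa [Real.log_exp] at this
  have h4 : (n : ℝ) * Real.log 4 ≤ c / U ^ 2 := h1.trans (h2.trans h3)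
  by_cases hU : U = 0
  · subst hU; simp; exact hc
  · have hU2' : 0 < U ^ 2 := by positivity
    rw [le_div_iff₀ hU2'] at h4
    linarith [h4]

/-! ## §2 The children, v3: the engine's ladder to `n_β + 1`, the volume-limit child, the assembly child -/

/-- **Child 3, v3: `EngineP3 Pr W`** — `EngineP2` (restaged: `R` before `Q`) with the scale ladder `n ≤ nScales β + 1`: the last step
integrates the thermal slice down to `Λ_{n_β+1} ≤ π/β`, where the action IS the fully integrated one (Δ-asm (B)).  Frames are admissible at
depth `nScales β` (the frame is not renormalised below `n_β`; the history `HistP … (n_β + 1)` it reads is the full tower of the four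
slots at `j ≤ n_β`, which children 1 and 2 — UNCHANGED, `BetaSplitP` / `CountertermP2` — supply). -/
def EngineP3 (Pr : Preds) (W : Set ℝ) : Prop :=
  ∃ G : GeoConsts, G.WF ∧ ∀ P : SplitConsts, P.WF → ∀ R : RenConsts, R.WF2 → ∃ Q : EngConsts, Q.WF ∧ ∀ c : ℝ, 0 < c →
    ∃ U₀ : ℝ, 0 < U₀ ∧ ∃ L₃ : ℝ → ℝ → ℕ, ∃ M₃ : ℝ → ℝ → ℕ → ℕ,
      ∀ μ ∈ W, ∀ U : ℝ, 0 < U → U ≤ U₀ → ∀ β : ℝ, klBetaMin ≤ β → β ≤ Real.exp (c / U ^ 2) →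
        ∀ K : TrigPolyC4v, Pr.frameOK R U (nScales β) μ K →
          ∀ (L M : ℕ) [NeZero L] [NeZero M], L₃ β U ≤ L → M₃ β U L ≤ M →
            ∀ n : ℕ, n ≤ nScales β + 1 → IsKLRegime U c (-(n : ℤ)) → HistP Pr L M G P Q R β U μ K n →
              Pr.engine L M G P Q β U μ K n ∧ Pr.twoLeg L M G P Q R β U μ K n

/-- **The type of the volume-limit slot**: `VL β U μ K Mstar` — «the fully integrated two-leg data of the frame `K` at `(β, U, μ)` have
termwise volume limits beyond the Matsubara thresholds `Mstar`» (text of record: hubbard-kl-r2d-p2's `FinalTwoLegVolLimit β U μ K Mstar` —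
`∃ Σ∞ : ℤ → (Fin 2 → ℝ) → Fin 2 → ℂ` continuous in the momentum and a bound `B` with, for every Matsubara label and every `ε > 0`,
eventually in `L` and then in `M ≥ Mstar L`, the two-leg vertex function of `klEffectiveAction … (nScales β + 1)` within `ε` of `Σ∞` and
bounded by `B`; bound by the bundle module, as `Preds` binds the per-scale slots). -/
abbrev VolLimitSlot : Type := ℝ → ℝ → ℝ → TrigPolyC4v → (ℕ → ℕ) → Prop

section Tower

variable (Pr : Preds)

/-- **The full tower of a frame beyond thresholds `(Lstar, Mstar)`**: at every `L ≥ Lstar`, `M ≥ Mstar L`, the four slots at every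
`n ≤ nScales β` AND the engine's output and two-leg step at the last index `nScales β + 1` (the fully integrated action). -/
def TowerP (G : GeoConsts) (P : SplitConsts) (Q : EngConsts) (R : RenConsts) (β U μ : ℝ) (K : TrigPolyC4v) (Lstar : ℕ)
    (Mstar : ℕ → ℕ) : Prop :=
  ∀ (L M : ℕ) [NeZero L] [NeZero M], Lstar ≤ L → Mstar L ≤ M →
    (∀ n : ℕ, n ≤ nScales β →
      Pr.renorm L M β U μ K R n ∧ Pr.split L M G P Q β U μ K n ∧
        Pr.engine L M G P Q β U μ K n ∧ Pr.twoLeg L M G P Q R β U μ K n) ∧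
    (Pr.engine L M G P Q β U μ K (nScales β + 1) ∧ Pr.twoLeg L M G P Q R β U μ K (nScales β + 1))

end Tower

/-- **Child 5, NEW: `VolumeLimitP Pr VL W`** (engine-side, ranked with child 3; Δ-asm (A)).  For all constants and every `c > 0` there
is `U₀ > 0` with: at every covariance potential `μ ∈ W` and regime point `(U, β)`, for every admissible frame `K` and thresholds
`(Lstar, Mstar)` beyond which `K` carries the full tower `TowerP`, the volume-limit predicate `VL β U μ K Mstar` holds — the termwise
`L`-limits of the expansion, which only the engine's summable single-slice majorants can supply (no per-volume slot can). -/
def VolumeLimitP (Pr : Preds) (VL : VolLimitSlot) (W : Set ℝ) : Prop :=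
  ∀ G : GeoConsts, ∀ P : SplitConsts, ∀ Q : EngConsts, ∀ R : RenConsts, G.WF → P.WF → Q.WF → R.WF →
    ∀ c : ℝ, 0 < c → ∃ U₀ : ℝ, 0 < U₀ ∧
      ∀ μ ∈ W, ∀ U : ℝ, 0 < U → U ≤ U₀ → ∀ β : ℝ, klBetaMin ≤ β → β ≤ Real.exp (c / U ^ 2) →
        ∀ K : TrigPolyC4v, Pr.frameOK R U (nScales β) μ K →
          ∀ (Lstar : ℕ) (Mstar : ℕ → ℕ), TowerP Pr G P Q R β U μ K Lstar Mstar → VL β U μ K Mstar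

/-- **Child 4, v3: `TwoPointAssemblyP3 Pr VL W`** (Δ-asm repaired, HARTREE-CORRECT).  As `TwoPointAssemblyP`, with the tower extended by
the last step `nScales β + 1` and with the volume-limit predicate `VL β U μ K Mstar` of THE SAME frame added to the hypothesis: IF there is
one admissible frame carrying the full tower beyond `(Lstar, Mstar)` AND its fully integrated two-leg data have termwise volume limits,
THEN the finite-volume equal-time thermal two-point functions at the physical potential `μ + U/2` converge as `L → ∞` (Matsubara-UV
identification at fixed `L`, Gaussian change of covariance, source-shift representation, Riemann sums of the free part, dominated
convergence over `k₀`). -/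
def TwoPointAssemblyP3 (Pr : Preds) (VL : VolLimitSlot) (W : Set ℝ) : Prop :=
  ∀ G : GeoConsts, ∀ P : SplitConsts, ∀ Q : EngConsts, ∀ R : RenConsts, G.WF → P.WF → Q.WF → R.WF →
    ∀ c : ℝ, 0 < c → ∃ U₀ : ℝ, 0 < U₀ ∧
      ∀ μ ∈ W, ∀ U : ℝ, 0 < U → U ≤ U₀ → ∀ β : ℝ, klBetaMin ≤ β → β ≤ Real.exp (c / U ^ 2) →
        ∀ (Lstar : ℕ) (Mstar : ℕ → ℕ),
          (∃ K : TrigPolyC4v, Pr.frameOK R U (nScales β) μ K ∧ TowerP Pr G P Q R β U μ K Lstar Mstar ∧ VL β U μ K Mstar) →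
          ∀ (x y : Site 2) (σ σ' : Fin 2), ∃ S : ℂ,
            Tendsto (fun L : ℕ => hubbardThermalTwoPoint β U (μ + U / 2) L x y σ σ') atTop (nhds S)

/-! ## §3 The five-child glue -/

/-- **GLUE, v3** (covariance window `W` receiving `μ - U/2`): `EngineP3`, `BetaSplitP`, `CountertermP2`, `VolumeLimitP`,
`TwoPointAssemblyP3` on `W` give K3 on the analysis window `KLRegimeTwoPointLimitMu (-1) (-0.15)`.  Order of choices `G → P → R → Q →
(c₀, c₁) → U₀` (five `U₀`'s); per `(μ, U, β)`: children 3 + 1 by strong induction to `n_β` for every admissible frame, child 2's frame,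
the engine's LAST step at `n_β + 1` on that frame's history, child 5's volume limits, child 4. -/
theorem inductionP3 {Pr : Preds} {VL : VolLimitSlot} {W : Set ℝ}
    (hW : ∀ μ ∈ Set.Icc (-1 : ℝ) (-0.15), ∀ U : ℝ, 0 < U → U ≤ 1 / 10 → μ - U / 2 ∈ W)
    (h₃ : EngineP3 Pr W) (h₁ : BetaSplitP Pr W) (h₂ : CountertermP2 Pr W) (h₅ : VolumeLimitP Pr VL W)
    (h₄ : TwoPointAssemblyP3 Pr VL W) :
    KLRegimeTwoPointLimitMu (-1) (-0.15) := by
  intro a ha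
  obtain ⟨G, hG, h₃P⟩ := h₃
  obtain ⟨P, hP, h₁Q⟩ := h₁ G hG
  obtain ⟨R, hR2, h₂Q⟩ := h₂ G P hG hP
  have hR : R.WF := hR2.wf
  obtain ⟨Q, hQ, h₃c⟩ := h₃P P hP R hR2
  obtain ⟨c₀, hc₀, h₁c⟩ := h₁Q Q hQ
  obtain ⟨c₁, hc₁, h₂c⟩ := h₂Q Q hQ
  set c : ℝ := min c₀ c₁ with hc_def
  have hc : 0 < c := lt_min hc₀ hc₁
  obtain ⟨U₃, hU₃, L₃, M₃, h₃main⟩ := h₃c c hc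
  obtain ⟨U₁, hU₁, L₁, M₁, h₁main⟩ := h₁c c hc (min_le_left _ _) R hR
  obtain ⟨U₂, hU₂, h₂main⟩ := h₂c c hc (min_le_right _ _)
  obtain ⟨U₅, hU₅, h₅main⟩ := h₅ G P Q R hG hP hQ hR c hc
  obtain ⟨U₄, hU₄, h₄main⟩ := h₄ G P Q R hG hP hQ hR c hc
  have hlog : 0 < Real.log klBetaMin := Real.log_pos (by norm_num [klBetaMin])
  set U₀ : ℝ := min (min (min (min U₁ U₂) (min U₃ (min U₄ U₅))) (a / Real.log klBetaMin)) (1 / 10) with hU₀_def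
  have hU₀ : 0 < U₀ :=
    lt_min (lt_min (lt_min (lt_min hU₁ hU₂) (lt_min hU₃ (lt_min hU₄ hU₅))) (div_pos ha hlog)) (by norm_num)
  refine ⟨U₀, c, hU₀, hc, ?_⟩
  intro μ hμ U β hU hUle hβa hβc x y σ σ'
  have hU5' : U ≤ min (min (min U₁ U₂) (min U₃ (min U₄ U₅))) (a / Real.log klBetaMin) := hUle.trans (min_le_left _ _)
  have hU10 : U ≤ 1 / 10 := hUle.trans (min_le_right _ _)
  have hUm : U ≤ min (min U₁ U₂) (min U₃ (min U₄ U₅)) := hU5'.trans (min_le_left _ _)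
  have hU1 : U ≤ U₁ := hUm.trans ((min_le_left _ _).trans (min_le_left _ _))
  have hU2 : U ≤ U₂ := hUm.trans ((min_le_left _ _).trans (min_le_right _ _))
  have hU3 : U ≤ U₃ := hUm.trans ((min_le_right _ _).trans (min_le_left _ _))
  have hU4 : U ≤ U₄ := hUm.trans ((min_le_right _ _).trans ((min_le_right _ _).trans (min_le_left _ _)))
  have hU5 : U ≤ U₅ := hUm.trans ((min_le_right _ _).trans ((min_le_right _ _).trans (min_le_right _ _)))
  have hβmin : klBetaMin ≤ β := klBetaMin_le_of_exp_le hU hU5' (min_le_right _ _) hβa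
  have hKL : ∀ n ≤ nScales β + 1, IsKLRegime U c (-(n : ℤ)) := fun n hn =>
    isKLRegime_of_le_nScales_succ hc.le hβmin hβc hn
  -- the covariance potential
  set ν : ℝ := μ - U / 2 with hν_def
  have hν : ν ∈ W := hW μ hμ U hU hU10
  -- the glued induction (children 3 + 1) up to `n_β` for EVERY admissible frame, beyond the maxed hypothesis thresholds
  have hall : ∀ K : TrigPolyC4v, Pr.frameOK R U (nScales β) ν K →
      ∀ (L M : ℕ) [NeZero L] [NeZero M], max (L₃ β U) (L₁ β U) ≤ L → max (M₃ β U L) (M₁ β U L) ≤ M →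
        ∀ n : ℕ, n ≤ nScales β → (∀ j < n, Pr.renorm L M β U ν K R j) →
          Pr.engine L M G P Q β U ν K n ∧ Pr.twoLeg L M G P Q R β U ν K n ∧
            Pr.split L M G P Q β U ν K n := by
    intro K hK L M _ _ hL hM n hn hRn
    have hL3 : L₃ β U ≤ L := (le_max_left _ _).trans hL
    have hL1 : L₁ β U ≤ L := (le_max_right _ _).trans hL
    have hM3 : M₃ β U L ≤ M := (le_max_left _ _).trans hM
    have hM1 : M₁ β U L ≤ M := (le_max_right _ _).trans hM
    exact Child.allScales (N := nScales β) (KL := fun n => IsKLRegime U c (-(n : ℤ)))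
      (B := fun n => Pr.split L M G P Q β U ν K n) (Rn := fun n => Pr.renorm L M β U ν K R n)
      (E := fun n => Pr.engine L M G P Q β U ν K n) (T := fun n => Pr.twoLeg L M G P Q R β U ν K n)
      (fun n hn hkl hyp => h₃main ν hν U hU hU3 β hβmin hβc K hK L M hL3 hM3 n (Nat.le_succ_of_le hn) hkl hyp)
      (fun n hn hkl hyp hEn hTn => h₁main ν hν U hU hU1 β hβmin hβc K hK L M hL1 hM1 n hn hkl hyp hEn hTn)
      (fun n hn => hKL n (Nat.le_succ_of_le hn)) n hn hRn
  -- child 2: the volume-uniform renormalised admissible frame and its thresholds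
  obtain ⟨K, hK, Lc, Mc, hKR⟩ :=
    h₂main ν hν U hU hU2 β hβmin hβc (max (L₃ β U) (L₁ β U)) (fun L => max (M₃ β U L) (M₁ β U L)) hall
  -- the full tower of K beyond the max of all thresholds, including the engine's LAST step `n_β + 1`
  set Lstar : ℕ := max Lc (max (L₃ β U) (L₁ β U)) with hLstar
  set Mstar : ℕ → ℕ := fun L => max (Mc L) (max (M₃ β U L) (M₁ β U L)) with hMstar
  have htower : TowerP Pr G P Q R β U ν K Lstar Mstar := by
    intro L M _ _ hL hM
    have hLc : Lc ≤ L := (le_max_left _ _).trans hL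
    have hLh : max (L₃ β U) (L₁ β U) ≤ L := (le_max_right _ _).trans hL
    have hL3 : L₃ β U ≤ L := (le_max_left _ _).trans hLh
    have hMc : Mc L ≤ M := (le_max_left _ _).trans hM
    have hMh : max (M₃ β U L) (M₁ β U L) ≤ M := (le_max_right _ _).trans hM
    have hM3 : M₃ β U L ≤ M := (le_max_left _ _).trans hMh
    have hle : ∀ n : ℕ, n ≤ nScales β →
        Pr.renorm L M β U ν K R n ∧ Pr.split L M G P Q β U ν K n ∧
          Pr.engine L M G P Q β U ν K n ∧ Pr.twoLeg L M G P Q R β U ν K n := by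
      intro n hn
      have h := hall K hK L M hLh hMh n hn fun j hj => hKR L M hLc hMc j (le_of_lt (lt_of_lt_of_le hj hn))
      exact ⟨hKR L M hLc hMc n hn, h.2.2, h.1, h.2.1⟩
    refine ⟨hle, ?_⟩
    -- the last step: history = the tower at `j ≤ n_β`
    have hhist : HistP Pr L M G P Q R β U ν K (nScales β + 1) := by
      intro j hj
      have hj' : j ≤ nScales β := Nat.lt_succ_iff.mp hj
      have h := hle j hj'
      exact ⟨h.2.1, h.1, h.2.2.1, h.2.2.2⟩
    exact h₃main ν hν U hU hU3 β hβmin hβc K hK L M hL3 hM3 (nScales β + 1) le_rfl (hKL _ le_rfl) hhist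
  -- child 5: termwise volume limits for this frame
  have hVL : VL β U ν K Mstar := h₅main ν hν U hU hU5 β hβmin hβc K hK Lstar Mstar htower
  -- child 4 at the covariance potential; its conclusion is at ν + U/2 = μ
  have hphys : ν + U / 2 = μ := by rw [hν_def]; ring
  have h4 := h₄main ν hν U hU hU4 β hβmin hβc Lstar Mstar ⟨K, hK, htower, hVL⟩ x y σ σ'
  rwa [hphys] at h4

/-- **GLUE, v3, on the covariance window `klWindowC`**: the five children give K3 on the analysis window. -/
theorem k3_inductionP3 {Pr : Preds} {VL : VolLimitSlot} (h₃ : EngineP3 Pr klWindowC) (h₁ : BetaSplitP Pr klWindowC)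
    (h₂ : CountertermP2 Pr klWindowC) (h₅ : VolumeLimitP Pr VL klWindowC) (h₄ : TwoPointAssemblyP3 Pr VL klWindowC) :
    KLRegimeTwoPointLimitMu (-1) (-0.15) :=
  inductionP3 (fun _ hμ _ hU hU' => sub_half_mem_klWindowC hμ hU hU') h₃ h₁ h₂ h₅ h₄

/-- **The crux modulo S0, from the five v3 children** (as `k3_twoPointLimit_of_childrenP`). -/
theorem k3_twoPointLimit_of_childrenP3 {Pr : Preds} {VL : VolLimitSlot} (h₃ : EngineP3 Pr klWindowC)
    (h₁ : BetaSplitP Pr klWindowC) (h₂ : CountertermP2 Pr klWindowC) (h₅ : VolumeLimitP Pr VL klWindowC)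
    (h₄ : TwoPointAssemblyP3 Pr VL klWindowC)
    (hS0 : ∀ δ ∈ Set.Icc (0.10 : ℝ) 0.35,
      chemicalPotentialOfDensity (squareDispersion 1 0) (1 - δ) ∈ Set.Icc (-1 : ℝ) (-0.15)) :
    ∀ a : ℝ, 0 < a → ∃ U₀ c : ℝ, 0 < U₀ ∧ 0 < c ∧ ∀ δ ∈ Set.Icc (0.10 : ℝ) 0.35, ∀ U β : ℝ, 0 < U → U ≤ U₀ →
      Real.exp (a / U) ≤ β → β ≤ Real.exp (c / U ^ 2) → ∀ (x y : Site 2) (σ σ' : Fin 2), ∃ S : ℂ,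
        Tendsto (fun L : ℕ => hubbardThermalTwoPoint β U
          (chemicalPotentialOfDensity (squareDispersion 1 0) (1 - δ)) L x y σ σ') atTop (nhds S) := by
  intro a ha
  obtain ⟨U₀, c, hU₀, hc, H⟩ := k3_inductionP3 h₃ h₁ h₂ h₅ h₄ a ha
  exact ⟨U₀, c, hU₀, hc, fun δ hδ U β hU hUle hβ hβ' x y σ σ' => H _ (hS0 δ hδ) U β hU hUle hβ hβ' x y σ σ'⟩

/-- The v3 engine child implies the v2 one (its ladder is longer): nothing proved towards `EngineP3` is lost on `EngineP2`. -/
theorem engineP2_of_engineP3 {Pr : Preds} {W : Set ℝ} (h : EngineP3 Pr W) : EngineP2 Pr W := by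
  obtain ⟨G, hG, hGP⟩ := h
  refine ⟨G, hG, fun P hP R hR => ?_⟩
  obtain ⟨Q, hQ, hc⟩ := hGP P hP R hR
  refine ⟨Q, hQ, fun c hc' => ?_⟩
  obtain ⟨U₀, hU₀, L₃, M₃, hmain⟩ := hc c hc'
  exact ⟨U₀, hU₀, L₃, M₃, fun μ hμ U hU hUle β hβ hβc K hK L M _ _ hL hM n hn hkl hhist =>
    hmain μ hμ U hU hUle β hβ hβc K hK L M hL hM n (Nat.le_succ_of_le hn) hkl hhist⟩

end Summit.HubbardSuperconductivity.HubbardSuperconductivity.Theorems.KLRegimeSplit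

end
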